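import Mathlib.RingTheory.Nullstellensatz
import Mathlib.RingTheory.Spectrum.Prime.Noetherian
import Mathlib.Topology.NoetherianSpace
import Mathlib.Algebra.MvPolynomial.Monad
import Mathlib.RingTheory.Spectrum.Prime.Chevalley
import Mathlib.RingTheory.Spectrum.Prime.Jacobson
import Mathlib.Topology.JacobsonSpace
import HarnessLib

/-!
# The Zariski topology on the points `kⁿ` of affine space; Chevalley's theorem on images
(trunk T-AUTOMORPHIC, G25 AutomorphicL)

Support for the structure theory of linear algebraic groups in the concrete `k`-points vocabulary
of `LinearAlgebraicGroups.lean` / `ZariskiGL.lean` (namespace `Literature.Automorphic`): there an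
algebraic group is a subgroup of `GL n k` cut out by polynomials in the coordinates
`x i j, det⁻¹`, i.e. a closed subset of the `k`-points of affine `(n² + 1)`-space. This file treats
affine space itself, following Springer, *Linear Algebraic Groups* (2nd ed.), Ch. 1:

* `zariskiTopologyPi σ k` — the Zariski topology on `σ → k`, *defined* as the topology induced
  from `PrimeSpectrum (MvPolynomial σ k)` along `x ↦ 𝔪_x` (Mathlib `MvPolynomial.pointToPoint`);
  a `def` used as a local instance only. Proved: the closed sets are exactly the zero loci
  (`isClosed_iff_exists_zeroLocus`, `isClosed_iff_exists_setOf_eval`; Springer 1.1.3), points are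
  closed, `x ↦ 𝔪_x` is an injective inducing map (`pointToPoint_injective`), polynomial maps are
  continuous (`continuous_of_polynomialMap`, via `pointToPoint_polynomialMap`:
  `𝔪_{φ(x)} = Spec(φ^*)(𝔪_x)`; Springer 1.4.7), `kⁿ` is Noetherian (`noetherianSpace_pi`,
  1.1.5 (ii));
* products `prodSet A B ⊆ k^{σ ⊕ τ}` of subsets `A ⊆ k^σ`, `B ⊆ k^τ` with the Zariski topology of
  `k^{σ ⊕ τ}` (not the product topology; Springer 1.5): closed / open / locally closed when the
  factors are, and **irreducible when the factors are** (`isIrreducible_prodSet`, Springer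
  1.5.4 (ii) — for `k`-points the slice argument works over any field);
* `exists_isOpen_inter_closure_subset_of_isConstructible` (topology): a constructible set with
  irreducible closure contains a non-empty open subset of its closure;
* **`exists_isOpen_inter_closure_image_subset` — Chevalley's theorem on images, Springer 1.9.5,
  for `k`-points over an algebraically closed field**: the image of a non-empty locally closed
  `V ⊆ kⁿ` under a polynomial map contains a non-empty open subset of its closure (reduction to
  the irreducible case `exists_isOpen_inter_closure_image_subset_of_isIrreducible` through the
  irreducible components, as printed). The irreducible case is *derived*
  from Mathlib's scheme-theoretic Chevalley theorem `PrimeSpectrum.isConstructible_comap_image`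
  by transport along `x ↦ 𝔪_x`, whose image is the set of closed points (`range_pointToPoint`,
  the Nullstellensatz `MvPolynomial.isMaximal_iff_eq_vanishingIdeal_singleton`), using that
  `Spec` of a finitely generated `k`-algebra is a Jacobson space (closed points are dense in
  locally closed subsets, Mathlib `nonempty_inter_closedPoints`).

These are the inputs of Springer 2.2.6–2.2.7 (groups generated by closed connected subgroups are
closed and connected) in this vocabulary.

## Mathlib

Used: `MvPolynomial.pointToPoint`, `MvPolynomial.zeroLocus` / `vanishingIdeal` and the
Nullstellensatz (`Mathlib.RingTheory.Nullstellensatz`), `PrimeSpectrum.comap`,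
`PrimeSpectrum.isConstructible_comap_image` (`Mathlib.RingTheory.Spectrum.Prime.Chevalley`),
`Topology.IsConstructible` with `BooleanSubalgebra.mem_closure_iff_sup_sdiff`, `JacobsonSpace`
(`PrimeSpectrum` of a Jacobson ring), `TopologicalSpace.NoetherianSpace`,
`RingHom.FinitePresentation.of_finiteType`. Mathlib has no Zariski topology on the naive points
`σ → k` (only on spectra), whence the local instance.

## References

* T. A. Springer, *Linear Algebraic Groups*, 2nd ed., Progress in Mathematics 9, Birkhäuser
  (1998), 1.1.2–1.1.3, 1.1.5, 1.2.3–1.2.4, 1.4.7, 1.5.1, 1.5.4 (ii), 1.5.5 (1), 1.9.4–1.9.6.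
-/

noncomputable section

open Topology

namespace Literature.NumberTheory.Automorphic

variable {k : Type*} [Field k] {σ τ : Type*}

/-! ### The Zariski topology on affine space `kⁿ` -/

/-- The **Zariski topology** on the `k`-points `σ → k` of affine space: the topology induced from
the prime spectrum of `k[x_σ]` along `x ↦ 𝔪_x = {p | p (x) = 0}` (Mathlib
`MvPolynomial.pointToPoint`), so that the closed sets are exactly the zero loci of ideals
(`isClosed_iff_exists_zeroLocus`; Springer 1.1.2–1.1.3). A `def`, used as a local instance only
(`σ → k` carries the product topology whenever `k` has a topology). [folklore] -/
@[implicit_reducible]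
def zariskiTopologyPi (σ k : Type*) [Field k] : TopologicalSpace (σ → k) :=
  TopologicalSpace.induced (MvPolynomial.pointToPoint (k := k)) inferInstance

attribute [local instance] zariskiTopologyPi

section Pi

/-- `x ↦ 𝔪_x` induces the Zariski topology of `kⁿ` (by definition). [folklore] -/
theorem isInducing_pointToPoint :
    IsInducing (MvPolynomial.pointToPoint (k := k) : (σ → k) → PrimeSpectrum (MvPolynomial σ k)) :=
  ⟨rfl⟩

/-- `x ↦ 𝔪_x` is continuous for the Zariski topology. [folklore] -/
theorem continuous_pointToPoint :
    Continuous (MvPolynomial.pointToPoint (k := k) : (σ → k) → PrimeSpectrum (MvPolynomial σ k)) :=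
  continuous_induced_dom

/-- `𝔪_x` determines `x` (the coordinate `x_i` is the constant `c` with `X_i - c ∈ 𝔪_x`).
[folklore] -/
theorem pointToPoint_injective :
    Function.Injective
      (MvPolynomial.pointToPoint (k := k) : (σ → k) → PrimeSpectrum (MvPolynomial σ k)) := by
  intro x y hxy
  funext i
  have h : MvPolynomial.X i - MvPolynomial.C (x i) ∈
      (MvPolynomial.vanishingIdeal k {x} : Ideal (MvPolynomial σ k)) := by
    rw [MvPolynomial.mem_vanishingIdeal_singleton_iff]; simp
  have h' : MvPolynomial.X i - MvPolynomial.C (x i) ∈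
      (MvPolynomial.vanishingIdeal k {y} : Ideal (MvPolynomial σ k)) := by
    have := congrArg PrimeSpectrum.asIdeal hxy
    simp only [MvPolynomial.pointToPoint] at this
    rwa [this] at h
  rw [MvPolynomial.mem_vanishingIdeal_singleton_iff] at h'
  simp only [map_sub, MvPolynomial.aeval_X, MvPolynomial.aeval_C, sub_eq_zero] at h'
  exact h'.symm

/-- The preimage of `V(I) ⊆ Spec k[x_σ]` in `kⁿ` is the zero locus `Z(I)`. [folklore] -/
theorem preimage_pointToPoint_zeroLocus (I : Ideal (MvPolynomial σ k)) :
    MvPolynomial.pointToPoint (k := k) ⁻¹' PrimeSpectrum.zeroLocus (I : Set (MvPolynomial σ k)) =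
      MvPolynomial.zeroLocus k I := by
  ext x
  simp only [Set.mem_preimage, PrimeSpectrum.mem_zeroLocus, MvPolynomial.mem_zeroLocus_iff,
    Set.subset_def, SetLike.mem_coe]
  exact forall₂_congr fun p _ => MvPolynomial.mem_vanishingIdeal_singleton_iff x p

/-- The Zariski-closed subsets of `kⁿ` are exactly the zero loci of ideals of `k[x_σ]`
(Springer 1.1.3). [folklore] -/
theorem isClosed_iff_exists_zeroLocus {Z : Set (σ → k)} :
    IsClosed Z ↔ ∃ I : Ideal (MvPolynomial σ k), Z = MvPolynomial.zeroLocus k I := by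
  rw [isClosed_induced_iff]
  constructor
  · rintro ⟨C, hC, rfl⟩
    obtain ⟨I, rfl⟩ := (PrimeSpectrum.isClosed_iff_zeroLocus_ideal C).1 hC
    exact ⟨I, preimage_pointToPoint_zeroLocus I⟩
  · rintro ⟨I, rfl⟩
    exact ⟨_, PrimeSpectrum.isClosed_zeroLocus _, preimage_pointToPoint_zeroLocus I⟩

/-- Zero loci are Zariski closed. [folklore] -/
theorem isClosed_zeroLocus_pi (I : Ideal (MvPolynomial σ k)) :
    IsClosed (MvPolynomial.zeroLocus k I : Set (σ → k)) :=
  isClosed_iff_exists_zeroLocus.2 ⟨I, rfl⟩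

/-- The common zeros of any set of polynomials form a Zariski-closed set. [folklore] -/
theorem isClosed_setOf_forall_eval_eq_zero (S : Set (MvPolynomial σ k)) :
    IsClosed {x : σ → k | ∀ p ∈ S, MvPolynomial.eval x p = 0} := by
  convert isClosed_zeroLocus_pi (Ideal.span S) using 1
  ext x
  simp only [Set.mem_setOf_eq, MvPolynomial.mem_zeroLocus_iff, MvPolynomial.aeval_eq_eval]
  constructor
  · intro h p hp
    refine Submodule.span_induction (p := fun p _ => MvPolynomial.eval x p = 0) h ?_ ?_ ?_ hp
    · simp
    · intro p q _ _ hp hq; simp [hp, hq]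
    · intro a p _ hp; simp [hp]
  · exact fun h p hp => h p (Ideal.subset_span hp)

/-- The Zariski-closed subsets of `kⁿ` are exactly the sets of common zeros of sets of polynomials.
[folklore] -/
theorem isClosed_iff_exists_setOf_eval {Z : Set (σ → k)} :
    IsClosed Z ↔ ∃ S : Set (MvPolynomial σ k), Z = {x | ∀ p ∈ S, MvPolynomial.eval x p = 0} := by
  constructor
  · intro hZ
    obtain ⟨I, rfl⟩ := isClosed_iff_exists_zeroLocus.1 hZ
    exact ⟨I, by ext x; simp [MvPolynomial.aeval_eq_eval]⟩
  · rintro ⟨S, rfl⟩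
    exact isClosed_setOf_forall_eval_eq_zero S

/-- The zeros of one polynomial form a Zariski-closed set (a hypersurface). [folklore] -/
theorem isClosed_setOf_eval_eq_zero (p : MvPolynomial σ k) :
    IsClosed {x : σ → k | MvPolynomial.eval x p = 0} := by
  simpa using isClosed_setOf_forall_eval_eq_zero {p}

/-- Points of `kⁿ` are Zariski closed (`{a}` is cut out by the `X_i - a_i`). [folklore] -/
theorem isClosed_singleton_pi (a : σ → k) : IsClosed ({a} : Set (σ → k)) := by
  convert isClosed_setOf_forall_eval_eq_zero
    (Set.range fun i : σ => MvPolynomial.X i - MvPolynomial.C (a i)) using 1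
  ext x
  simp only [Set.mem_singleton_iff, Set.mem_setOf_eq, Set.forall_mem_range, map_sub,
    MvPolynomial.eval_X, MvPolynomial.eval_C, sub_eq_zero]
  exact ⟨fun h i => by rw [h], fun h => funext h⟩

/-- `MvPolynomial.eval` commutes with substitution `bind₁` (Mathlib `MvPolynomial.eval₂Hom_bind₁`
for the identity ring map; cf. `Literature.NumberTheory.Automorphic.eval_bind₁` in `LinearAlgebraicGroups.lean`).
[folklore] -/
lemma eval_bind₁' (x : σ → k) (h : τ → MvPolynomial σ k) (φ : MvPolynomial τ k) :
    MvPolynomial.eval x (MvPolynomial.bind₁ h φ) =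
      MvPolynomial.eval (fun i => MvPolynomial.eval x (h i)) φ :=
  MvPolynomial.eval₂Hom_bind₁ _ _ _ _

/-- A *polynomial map* `kⁿ → kᵐ`, `x ↦ (P_t (x))_t`, intertwines `x ↦ 𝔪_x` with the comorphism
`Spec` of the substitution `X_t ↦ P_t` (Springer 1.4.7). [folklore] -/
theorem pointToPoint_polynomialMap (P : τ → MvPolynomial σ k) (x : σ → k) :
    MvPolynomial.pointToPoint (k := k) (fun t => MvPolynomial.eval x (P t)) =
      PrimeSpectrum.comap (MvPolynomial.bind₁ P).toRingHom (MvPolynomial.pointToPoint x) := by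
  ext p
  change p ∈ (MvPolynomial.vanishingIdeal k {fun t => MvPolynomial.eval x (P t)} :
      Ideal (MvPolynomial τ k)) ↔
    (MvPolynomial.bind₁ P) p ∈ (MvPolynomial.vanishingIdeal k {x} : Ideal (MvPolynomial σ k))
  rw [MvPolynomial.mem_vanishingIdeal_singleton_iff, MvPolynomial.mem_vanishingIdeal_singleton_iff,
    MvPolynomial.aeval_eq_eval, MvPolynomial.aeval_eq_eval, eval_bind₁']

/-- Polynomial maps `kⁿ → kᵐ` are Zariski continuous (Springer 1.4.7). [folklore] -/
theorem continuous_of_polynomialMap {φ : (σ → k) → (τ → k)} (P : τ → MvPolynomial σ k)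
    (hφ : ∀ x t, φ x t = MvPolynomial.eval x (P t)) : Continuous φ := by
  have hφ' : φ = fun x t => MvPolynomial.eval x (P t) := funext fun x => funext (hφ x)
  rw [continuous_induced_rng, hφ']
  have : MvPolynomial.pointToPoint (k := k) ∘ (fun (x : σ → k) (t : τ) => MvPolynomial.eval x (P t))
      = PrimeSpectrum.comap (MvPolynomial.bind₁ P).toRingHom ∘ MvPolynomial.pointToPoint :=
    funext (pointToPoint_polynomialMap P)
  rw [this]
  exact (PrimeSpectrum.continuous_comap _).comp continuous_pointToPoint

/-- Affine space `kⁿ` (`n` finite) is a Noetherian topological space for the Zariski topology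
(Hilbert's basis theorem; Springer 1.1.5 (ii)). [folklore] -/
theorem noetherianSpace_pi [Finite σ] : TopologicalSpace.NoetherianSpace (σ → k) :=
  (isInducing_pointToPoint (σ := σ) (k := k)).noetherianSpace

/-! ### Products `A × B ⊆ k^{σ ⊕ τ}` -/

section ProdSet

variable {R : Type*}

/-- The product `A × B ⊆ R^{σ ⊕ τ} = Rᵐ × Rⁿ` of subsets `A ⊆ R^σ`, `B ⊆ R^τ`, as a set of points of
affine `(m + n)`-space — to be equipped with *its* Zariski topology, which is not the product
topology (Springer 1.5.1, 1.5.4, 1.5.5 (1)). Definitionally the preimage of `A ×ˢ B` under Mathlib's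
`Equiv.sumArrowEquivProdArrow σ τ R` (`prodSet_eq_preimage_prod`), through which `Set.prod` lemmas
transfer. [folklore] -/
def prodSet (A : Set (σ → R)) (B : Set (τ → R)) : Set (σ ⊕ τ → R) :=
  {v | (fun i => v (Sum.inl i)) ∈ A ∧ (fun j => v (Sum.inr j)) ∈ B}

/-- `prodSet A B` is the preimage of `A ×ˢ B` under `(σ ⊕ τ → R) ≃ (σ → R) × (τ → R)`. [folklore] -/
lemma prodSet_eq_preimage_prod (A : Set (σ → R)) (B : Set (τ → R)) :
    prodSet A B = Equiv.sumArrowEquivProdArrow σ τ R ⁻¹' (A ×ˢ B) := rfl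

/-- Membership in `prodSet`. [folklore] -/
@[simp] lemma mem_prodSet {A : Set (σ → R)} {B : Set (τ → R)} {v : σ ⊕ τ → R} :
    v ∈ prodSet A B ↔ (fun i => v (Sum.inl i)) ∈ A ∧ (fun j => v (Sum.inr j)) ∈ B := Iff.rfl

/-- Membership of a pair `(a, b) = Sum.elim a b` in `prodSet`. [folklore] -/
lemma sumElim_mem_prodSet {A : Set (σ → R)} {B : Set (τ → R)} {a : σ → R} {b : τ → R} :
    Sum.elim a b ∈ prodSet A B ↔ a ∈ A ∧ b ∈ B := Iff.rfl

/-- Every point of `R^{σ ⊕ τ}` is a pair. [folklore] -/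
lemma sumElim_inl_inr (v : σ ⊕ τ → R) :
    Sum.elim (fun i => v (Sum.inl i)) (fun j => v (Sum.inr j)) = v :=
  funext fun c => by cases c <;> rfl

/-- `prodSet` is monotone. [folklore] -/
lemma prodSet_mono {A A' : Set (σ → R)} {B B' : Set (τ → R)} (hA : A ⊆ A') (hB : B ⊆ B') :
    prodSet A B ⊆ prodSet A' B' := fun _ hv => ⟨hA hv.1, hB hv.2⟩

/-- `prodSet A B` is the intersection of the preimages of `A` and `B` under the projections.
[folklore] -/
lemma prodSet_eq_inter_preimage (A : Set (σ → R)) (B : Set (τ → R)) :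
    prodSet A B = (fun (v : σ ⊕ τ → R) (i : σ) => v (Sum.inl i)) ⁻¹' A ∩
      (fun (v : σ ⊕ τ → R) (j : τ) => v (Sum.inr j)) ⁻¹' B := rfl

/-- `prodSet` commutes with binary intersections. [folklore] -/
lemma prodSet_inter_prodSet (A A' : Set (σ → R)) (B B' : Set (τ → R)) :
    prodSet A B ∩ prodSet A' B' = prodSet (A ∩ A') (B ∩ B') := by
  ext v; simp only [Set.mem_inter_iff, mem_prodSet]; tauto

end ProdSet

/-- The first projection `k^{σ ⊕ τ} → k^σ` is Zariski continuous. [folklore] -/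
theorem continuous_restrict_inl : Continuous fun (v : σ ⊕ τ → k) (i : σ) => v (Sum.inl i) :=
  continuous_of_polynomialMap (fun i => MvPolynomial.X (Sum.inl i)) fun v i => by simp

/-- The second projection `k^{σ ⊕ τ} → k^τ` is Zariski continuous. [folklore] -/
theorem continuous_restrict_inr : Continuous fun (v : σ ⊕ τ → k) (j : τ) => v (Sum.inr j) :=
  continuous_of_polynomialMap (fun j => MvPolynomial.X (Sum.inr j)) fun v j => by simp

/-- The section `a ↦ (a, b)` is Zariski continuous. [folklore] -/
theorem continuous_sumElim_left (b : τ → k) : Continuous fun a : σ → k => Sum.elim a b :=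
  continuous_of_polynomialMap (Sum.elim (fun i => MvPolynomial.X i) fun j => MvPolynomial.C (b j))
    fun a c => by cases c <;> simp

/-- The section `b ↦ (a, b)` is Zariski continuous. [folklore] -/
theorem continuous_sumElim_right (a : σ → k) : Continuous fun b : τ → k => Sum.elim a b :=
  continuous_of_polynomialMap (Sum.elim (fun i => MvPolynomial.C (a i)) fun j => MvPolynomial.X j)
    fun b c => by cases c <;> simp

/-- Products of closed sets are closed. [folklore] -/
theorem isClosed_prodSet {A : Set (σ → k)} {B : Set (τ → k)} (hA : IsClosed A) (hB : IsClosed B) :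
    IsClosed (prodSet A B) :=
  (hA.preimage continuous_restrict_inl).inter (hB.preimage continuous_restrict_inr)

/-- Products of open sets are open. [folklore] -/
theorem isOpen_prodSet {A : Set (σ → k)} {B : Set (τ → k)} (hA : IsOpen A) (hB : IsOpen B) :
    IsOpen (prodSet A B) :=
  (hA.preimage continuous_restrict_inl).inter (hB.preimage continuous_restrict_inr)

/-- Products of locally closed sets are locally closed. [folklore] -/
theorem isLocallyClosed_prodSet {A : Set (σ → k)} {B : Set (τ → k)} (hA : IsLocallyClosed A)
    (hB : IsLocallyClosed B) : IsLocallyClosed (prodSet A B) := by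
  obtain ⟨U, Z, hU, hZ, rfl⟩ := hA
  obtain ⟨U', Z', hU', hZ', rfl⟩ := hB
  rw [← prodSet_inter_prodSet]
  exact ⟨_, _, isOpen_prodSet hU hU', isClosed_prodSet hZ hZ', rfl⟩

/-- **Products of irreducible sets are irreducible** (Springer 1.5.4 (ii), for sets of `k`-points,
over any field): if `A × B ⊆ Z₁ ∪ Z₂` with `Z_i` closed, each slice `{a} × B ≅ B` lies in some
`Z_i`, and `{a | {a} × B ⊆ Z_i}` is closed. [folklore] -/
theorem isIrreducible_prodSet {A : Set (σ → k)} {B : Set (τ → k)} (hA : IsIrreducible A)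
    (hB : IsIrreducible B) : IsIrreducible (prodSet A B) := by
  obtain ⟨a₀, ha₀⟩ := hA.nonempty
  obtain ⟨b₀, hb₀⟩ := hB.nonempty
  refine ⟨⟨Sum.elim a₀ b₀, ha₀, hb₀⟩, ?_⟩
  rw [isPreirreducible_iff_isClosed_union_isClosed]
  intro Z₁ Z₂ hZ₁ hZ₂ hAB
  let C : Set (σ ⊕ τ → k) → Set (σ → k) := fun Z => ⋂ b ∈ B, (fun a => Sum.elim a b) ⁻¹' Z
  have hC : ∀ Z, IsClosed Z → IsClosed (C Z) := fun Z hZ =>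
    isClosed_biInter fun b _ => hZ.preimage (continuous_sumElim_left b)
  have hmemC : ∀ {Z a}, a ∈ C Z ↔ ∀ b ∈ B, Sum.elim a b ∈ Z := fun {Z a} => by
    simp only [C, Set.mem_iInter, Set.mem_preimage]
  have hAC : A ⊆ C Z₁ ∪ C Z₂ := by
    intro a ha
    have hirr : IsIrreducible ((fun b : τ → k => Sum.elim a b) '' B) :=
      hB.image _ (continuous_sumElim_right a).continuousOn
    have hsub : (fun b : τ → k => Sum.elim a b) '' B ⊆ Z₁ ∪ Z₂ := by
      rintro _ ⟨b, hb, rfl⟩; exact hAB ⟨ha, hb⟩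
    rcases (isPreirreducible_iff_isClosed_union_isClosed.1 hirr.2) Z₁ Z₂ hZ₁ hZ₂ hsub with h | h
    · exact Or.inl (hmemC.2 fun b hb => h ⟨b, hb, rfl⟩)
    · exact Or.inr (hmemC.2 fun b hb => h ⟨b, hb, rfl⟩)
  rcases (isPreirreducible_iff_isClosed_union_isClosed.1 hA.2) _ _ (hC Z₁ hZ₁) (hC Z₂ hZ₂) hAC
    with h | h
  · left
    intro v hv
    rw [← sumElim_inl_inr v]
    exact hmemC.1 (h hv.1) _ hv.2
  · right
    intro v hv
    rw [← sumElim_inl_inr v]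
    exact hmemC.1 (h hv.1) _ hv.2

end Pi

/-! ### Chevalley's theorem on images, for `k`-points (Springer 1.9.5) -/

section Constructible

open Topology in
/-- A constructible set whose closure is irreducible contains a non-empty open subset of its
closure: writing it as a finite union of differences `U \ V` of open sets, the closure is the
closure of one of them. (The topological half of Springer 1.9.5 / 1.9.6 (1).) [folklore] -/
theorem exists_isOpen_inter_closure_subset_of_isConstructible {X : Type*} [TopologicalSpace X]
    {C : Set X} (hC : IsConstructible C) (hirr : IsIrreducible (closure C)) :
    ∃ O : Set X, IsOpen O ∧ (O ∩ closure C).Nonempty ∧ O ∩ closure C ⊆ C := by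
  classical
  -- `C` is a finite union of `U \ V`, `U, V` open (retrocompact)
  have hsub : IsSublattice {U : Set X | IsOpen U ∧ IsRetrocompact U} :=
    ⟨fun U hU V hV => ⟨hU.1.union hV.1, hU.2.union hV.2⟩,
      fun U hU V hV => ⟨hU.1.inter hV.1, hU.2.inter_isOpen hV.2 hV.1⟩⟩
  have hbot : (⊥ : Set X) ∈ {U : Set X | IsOpen U ∧ IsRetrocompact U} := ⟨isOpen_empty, .empty⟩
  have htop : (⊤ : Set X) ∈ {U : Set X | IsOpen U ∧ IsRetrocompact U} := ⟨isOpen_univ, .univ⟩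
  obtain ⟨t, ht⟩ := (BooleanSubalgebra.mem_closure_iff_sup_sdiff hsub hbot htop).mp hC
  let f : ↥{U : Set X | IsOpen U ∧ IsRetrocompact U} × ↥{U : Set X | IsOpen U ∧ IsRetrocompact U} →
      Set X := fun x => x.1.1 \ x.2.1
  have hCf : C = ⋃ x ∈ t, f x := by rw [ht, ← Finset.sup_set_eq_biUnion]
  have hclC : closure C = ⋃ x ∈ t, closure (f x) := by rw [hCf, Finset.closure_biUnion]
  -- the irreducible `closure C` lies in one `closure (U \ V)`
  obtain ⟨Z, hZ, hCZ⟩ := isIrreducible_iff_sUnion_isClosed.1 hirr (t.image fun x => closure (f x))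
    (by simp only [Finset.mem_image]; rintro _ ⟨x, _, rfl⟩; exact isClosed_closure)
    (by
      rw [Finset.coe_image, Set.sUnion_image, hclC]
      intro y hy
      simpa only [Finset.mem_coe] using hy)
  obtain ⟨x, hxt, rfl⟩ := Finset.mem_image.1 hZ
  obtain ⟨⟨U, hU⟩, ⟨V, hV⟩⟩ := x
  -- take `O = U`
  refine ⟨U, hU.1, ?_, ?_⟩
  · have hne : (U \ V).Nonempty := by
      by_contra h
      rw [Set.not_nonempty_iff_eq_empty] at h
      have : closure C = ∅ := Set.subset_eq_empty hCZ (by simp [f, h])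
      exact hirr.nonempty.ne_empty this
    obtain ⟨y, hyU, hyV⟩ := hne
    refine ⟨y, hyU, subset_closure ?_⟩
    rw [hCf]
    exact Set.mem_biUnion hxt ⟨hyU, hyV⟩
  · intro y hy
    have hyUV : y ∈ closure (U \ V) := hCZ hy.2
    have hyV : y ∉ V := by
      have : closure (U \ V) ⊆ Vᶜ :=
        closure_minimal (fun z hz => hz.2) hV.1.isClosed_compl
      exact this hyUV
    rw [hCf]
    exact Set.mem_biUnion hxt ⟨hy.1, hyV⟩

/-- In a Noetherian space every subset is retrocompact, so every open set is constructible.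
[folklore] -/
theorem isConstructible_of_isOpen {X : Type*} [TopologicalSpace X]
    [TopologicalSpace.NoetherianSpace X] {U : Set X} (hU : IsOpen U) : IsConstructible U :=
  IsRetrocompact.isConstructible hU fun _ _ _ => TopologicalSpace.NoetherianSpace.isCompact _

/-- In a Noetherian space every closed set is constructible (this is
`Literature.NumberTheory.Transcendental.isConstructible_of_isClosed` of
`Literature/NumberTheory/Transcendental/AnalytificationProper.lean`, restated to avoid importing
schemes). [folklore] -/
theorem isConstructible_of_isClosed' {X : Type*} [TopologicalSpace X]
    [TopologicalSpace.NoetherianSpace X] {Z : Set X} (hZ : IsClosed Z) : IsConstructible Z := by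
  simpa using (isConstructible_of_isOpen hZ.isOpen_compl).compl

/-- In a Noetherian space every locally closed set is constructible. [folklore] -/
theorem IsLocallyClosed.isConstructible' {X : Type*} [TopologicalSpace X]
    [TopologicalSpace.NoetherianSpace X] {S : Set X} (hS : IsLocallyClosed S) :
    IsConstructible S := by
  obtain ⟨U, Z, hU, hZ, rfl⟩ := hS
  exact (isConstructible_of_isOpen hU).inter (isConstructible_of_isClosed' hZ)

end Constructible

section Chevalley

variable [Finite σ] [Finite τ]

/-- The substitution `X_t ↦ P_t`, `k[x_τ] → k[x_σ]`, is of finite presentation (`k[x_σ]` is of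
finite type over `k`, a fortiori over `k[x_τ]`, which is Noetherian). [folklore] -/
theorem finitePresentation_bind₁ (P : τ → MvPolynomial σ k) :
    (MvPolynomial.bind₁ P).toRingHom.FinitePresentation := by
  refine RingHom.FinitePresentation.of_finiteType.mp ?_
  refine RingHom.FiniteType.of_comp_finiteType (f := algebraMap k (MvPolynomial τ k)) ?_
  have : (MvPolynomial.bind₁ P).toRingHom.comp (algebraMap k (MvPolynomial τ k)) =
      algebraMap k (MvPolynomial σ k) := (MvPolynomial.bind₁ P).comp_algebraMap
  rw [this]
  exact RingHom.finiteType_algebraMap.mpr inferInstance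

variable [IsAlgClosed k]

/-- **Hilbert's Nullstellensatz, topological form**: over an algebraically closed field the points
of `kⁿ` are exactly the closed points of `Spec k[x_1, …, x_n]`, i.e. the maximal ideals of
`k[x_1, …, x_n]` are the `𝔪_x` (Mathlib `MvPolynomial.isMaximal_iff_eq_vanishingIdeal_singleton`).
[cite: SpringerLAG1998, Prop 1.1.2] -/
theorem range_pointToPoint :
    Set.range (MvPolynomial.pointToPoint (k := k) : (σ → k) → PrimeSpectrum (MvPolynomial σ k)) =
      closedPoints (PrimeSpectrum (MvPolynomial σ k)) := by
  ext p
  rw [mem_closedPoints_iff, PrimeSpectrum.isClosed_singleton_iff_isMaximal,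
    MvPolynomial.isMaximal_iff_eq_vanishingIdeal_singleton]
  constructor
  · rintro ⟨x, rfl⟩
    exact ⟨x, rfl⟩
  · rintro ⟨x, hx⟩
    exact ⟨x, PrimeSpectrum.ext hx.symm⟩

/-- **Chevalley's theorem on images (Springer 1.9.5), for `k`-points — irreducible case.** Let `k`
be algebraically closed, `V ⊆ kⁿ` an irreducible locally closed subset and `φ : kⁿ → kᵐ` a
polynomial map. Then `φ (V)` contains a non-empty open subset of its closure: there is a
Zariski-open `W ⊆ kᵐ` meeting `closure (φ V)` with `W ∩ closure (φ V) ⊆ φ (V)`. Proof: transport to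
prime spectra along the embeddings `x ↦ 𝔪_x` (whose images are the closed points, by the
Nullstellensatz), apply Mathlib's constructibility theorem
`PrimeSpectrum.isConstructible_comap_image` to the constructible set of primes lying over `V`, and
come back using that `Spec` of a finitely generated `k`-algebra is a Jacobson space (closed points
are dense in every locally closed subset). The general case (`V` not irreducible) is
`exists_isOpen_inter_closure_image_subset` below. [cite: SpringerLAG1998, Thm 1.9.5 (proof)] -/
theorem exists_isOpen_inter_closure_image_subset_of_isIrreducible {V : Set (σ → k)}
    (hV : IsLocallyClosed V) (hVirr : IsIrreducible V) {φ : (σ → k) → (τ → k)}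
    (P : τ → MvPolynomial σ k)
    (hφ : ∀ x t, φ x t = MvPolynomial.eval x (P t)) :
    ∃ W : Set (τ → k), IsOpen W ∧ (W ∩ closure (φ '' V)).Nonempty ∧
      W ∩ closure (φ '' V) ⊆ φ '' V := by
  classical
  -- notation
  set e : (σ → k) → PrimeSpectrum (MvPolynomial σ k) := MvPolynomial.pointToPoint (k := k)
    with hedef
  set e' : (τ → k) → PrimeSpectrum (MvPolynomial τ k) := MvPolynomial.pointToPoint (k := k)
    with he'def
  set cf : PrimeSpectrum (MvPolynomial σ k) → PrimeSpectrum (MvPolynomial τ k) :=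
    PrimeSpectrum.comap (MvPolynomial.bind₁ P).toRingHom with hcfdef
  have he_ind : IsInducing e := isInducing_pointToPoint
  have he'_ind : IsInducing e' := isInducing_pointToPoint
  have hcf_cont : Continuous cf := PrimeSpectrum.continuous_comap _
  have hφ' : φ = fun x t => MvPolynomial.eval x (P t) := funext fun x => funext (hφ x)
  have hφ_cont : Continuous φ := continuous_of_polynomialMap P hφ
  have hcomm : ∀ x, e' (φ x) = cf (e x) := fun x => by
    rw [hφ']; exact pointToPoint_polynomialMap P x
  -- `V = U ∩ C`, `U = e ⁻¹' Ũ`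
  obtain ⟨U, C, hU, hC, rfl⟩ := hV
  obtain ⟨Ut, hUt, rfl⟩ := isOpen_induced_iff.1 hU
  -- the constructible set `Ṽ = closure (e V) ∩ Ũ` of primes, with `e ⁻¹' Ṽ = V`
  set Vt : Set (PrimeSpectrum (MvPolynomial σ k)) := closure (e '' (e ⁻¹' Ut ∩ C)) ∩ Ut with hVt
  have hVt_pre : e ⁻¹' Vt = e ⁻¹' Ut ∩ C := by
    rw [hVt, Set.preimage_inter, ← he_ind.closure_eq_preimage_closure_image]
    refine Set.Subset.antisymm ?_ fun x hx => ⟨subset_closure hx, hx.1⟩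
    rintro x ⟨hxcl, hxU⟩
    exact ⟨hxU, closure_minimal Set.inter_subset_right hC hxcl⟩
  have hVt_cons : IsConstructible Vt :=
    (isConstructible_of_isClosed' isClosed_closure).inter (isConstructible_of_isOpen hUt)
  have heV_sub : e '' (e ⁻¹' Ut ∩ C) ⊆ Vt := by
    rintro _ ⟨x, hx, rfl⟩
    exact ⟨subset_closure ⟨x, hx, rfl⟩, hx.1⟩
  -- its image `S`, constructible by Chevalley, with closure the closure of `e' (φ V)`
  set S : Set (PrimeSpectrum (MvPolynomial τ k)) := cf '' Vt with hS
  have hS_cons : IsConstructible S :=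
    PrimeSpectrum.isConstructible_comap_image (finitePresentation_bind₁ P) hVt_cons
  have himage : e' '' (φ '' (e ⁻¹' Ut ∩ C)) = cf '' (e '' (e ⁻¹' Ut ∩ C)) := by
    rw [Set.image_image, Set.image_image]
    exact Set.image_congr fun x _ => hcomm x
  have hS_ge : e' '' (φ '' (e ⁻¹' Ut ∩ C)) ⊆ S := by
    rw [himage]; exact Set.image_mono heV_sub
  have hS_le : S ⊆ closure (e' '' (φ '' (e ⁻¹' Ut ∩ C))) := by
    rw [himage, hS, hVt]
    exact (Set.image_mono Set.inter_subset_left).trans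
      (image_closure_subset_closure_image hcf_cont)
  have hclS : closure S = closure (e' '' (φ '' (e ⁻¹' Ut ∩ C))) :=
    Set.Subset.antisymm (closure_minimal hS_le isClosed_closure) (closure_mono hS_ge)
  have hirrS : IsIrreducible (closure S) := by
    rw [hclS]
    exact ((hVirr.image φ hφ_cont.continuousOn).image e' he'_ind.continuous.continuousOn).closure
  -- the open set
  obtain ⟨O, hO, hOne, hOS⟩ := exists_isOpen_inter_closure_subset_of_isConstructible hS_cons hirrS
  have hclφ : closure (φ '' (e ⁻¹' Ut ∩ C)) = e' ⁻¹' closure S := by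
    rw [hclS]; exact he'_ind.closure_eq_preimage_closure_image _
  refine ⟨e' ⁻¹' O, hO.preimage he'_ind.continuous, ?_, ?_⟩
  · -- a closed point of the non-empty locally closed `O ∩ closure S`
    obtain ⟨m, hm, hmcl⟩ := nonempty_inter_closedPoints hOne (hO.isLocallyClosed.inter
      isClosed_closure.isLocallyClosed)
    rw [← range_pointToPoint] at hmcl
    obtain ⟨y, rfl⟩ := hmcl
    exact ⟨y, hm.1, by rw [hclφ]; exact hm.2⟩
  · rintro y ⟨hyO, hycl⟩
    rw [hclφ] at hycl
    obtain ⟨q, hqVt, hqy⟩ := hOS ⟨hyO, hycl⟩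
    -- a closed point `e x` of `closure {q} ∩ Ũ`; then `x ∈ V` and `φ x = y`
    obtain ⟨m, ⟨hmq, hmU⟩, hmcl⟩ := nonempty_inter_closedPoints (Z := closure {q} ∩ Ut)
      ⟨q, subset_closure rfl, hqVt.2⟩ (isClosed_closure.isLocallyClosed.inter hUt.isLocallyClosed)
    rw [← range_pointToPoint] at hmcl
    obtain ⟨x, rfl⟩ := hmcl
    have hxV : x ∈ e ⁻¹' Ut ∩ C := by
      rw [← hVt_pre]
      refine ⟨?_, hmU⟩
      exact closure_minimal (Set.singleton_subset_iff.2 hqVt.1) isClosed_closure hmq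
    refine ⟨x, hxV, ?_⟩
    -- `cf (e x)` specialises `cf q = e' y`, a closed point
    have hy_closed : IsClosed ({e' y} : Set (PrimeSpectrum (MvPolynomial τ k))) := by
      rw [← mem_closedPoints_iff, ← range_pointToPoint]; exact ⟨y, rfl⟩
    have h1 : cf (e x) ∈ closure {cf q} := by
      have := image_closure_subset_closure_image hcf_cont ⟨e x, hmq, rfl⟩
      rwa [Set.image_singleton] at this
    rw [hqy, hy_closed.closure_eq, Set.mem_singleton_iff, ← hcomm] at h1
    exact pointToPoint_injective h1

/-- A non-empty relatively open subset of an irreducible set is irreducible. [folklore] -/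
lemma isIrreducible_isOpen_inter {X : Type*} [TopologicalSpace X] {Z U : Set X}
    (hZ : IsIrreducible Z) (hU : IsOpen U) (hne : (U ∩ Z).Nonempty) : IsIrreducible (U ∩ Z) := by
  refine ⟨hne, fun u v hu hv ⟨x, ⟨hxU, hxZ⟩, hxu⟩ ⟨y, ⟨hyU, hyZ⟩, hyv⟩ => ?_⟩
  obtain ⟨z, hzZ, ⟨hzu, hzU⟩, hzv, -⟩ := hZ.2 (u ∩ U) (v ∩ U) (hu.inter hU) (hv.inter hU)
    ⟨x, hxZ, hxu, hxU⟩ ⟨y, hyZ, hyv, hyU⟩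
  exact ⟨z, ⟨hzU, hzZ⟩, hzu, hzv⟩

/-- **Chevalley's theorem on images (Springer 1.9.5), for `k`-points**: *let `φ : X → Y` be a
morphism of varieties; then `φ X` contains a non-empty open subset of its closure* — here for a
polynomial map `φ : kⁿ → kᵐ` over an algebraically closed field and a non-empty locally closed
`V ⊆ kⁿ` in place of `X`. As in the printed proof, one reduces to the irreducible case
(`exists_isOpen_inter_closure_image_subset_of_isIrreducible`) through the finitely many irreducible
components `Z_j` of `closure V` (`kⁿ` is Noetherian): with `W_j = closure (φ (V ∩ Z_j))` and
`W_{j₀}` maximal among the non-empty ones, an open set meeting `W_{j₀}` inside `φ (V ∩ Z_{j₀})`,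
minus the `W_j ⊉ W_{j₀}`, works. [cite: SpringerLAG1998, Thm 1.9.5] -/
theorem exists_isOpen_inter_closure_image_subset {V : Set (σ → k)} (hV : IsLocallyClosed V)
    (hVne : V.Nonempty) {φ : (σ → k) → (τ → k)} (P : τ → MvPolynomial σ k)
    (hφ : ∀ x t, φ x t = MvPolynomial.eval x (P t)) :
    ∃ W : Set (τ → k), IsOpen W ∧ (W ∩ closure (φ '' V)).Nonempty ∧
      W ∩ closure (φ '' V) ⊆ φ '' V := by
  classical
  haveI := noetherianSpace_pi (σ := σ) (k := k)
  have hφ_cont : Continuous φ := continuous_of_polynomialMap P hφ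
  obtain ⟨U, C, hU, hC, rfl⟩ := hV
  -- `V = U ∩ closure V`
  have hVU : U ∩ C = U ∩ closure (U ∩ C) :=
    Set.Subset.antisymm (fun x hx => ⟨hx.1, subset_closure hx⟩)
      fun x hx => ⟨hx.1, closure_minimal Set.inter_subset_right hC hx.2⟩
  -- irreducible components of `closure V`
  obtain ⟨𝓕, h𝓕fin, h𝓕cl, h𝓕irr, h𝓕⟩ :=
    TopologicalSpace.NoetherianSpace.exists_finite_set_isClosed_irreducible
      (isClosed_closure (s := U ∩ C))
  -- the pieces `V ∩ Z` and the closures `W Z` of their images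
  let W : Set (σ → k) → Set (τ → k) := fun Z => closure (φ '' (U ∩ Z))
  have hVdec : U ∩ C = ⋃ Z ∈ 𝓕, U ∩ Z := by
    conv_lhs => rw [hVU, h𝓕]
    ext x
    simp only [Set.mem_inter_iff, Set.mem_sUnion, Set.mem_iUnion, exists_and_left, exists_prop]
  have hcldec : closure (φ '' (U ∩ C)) = ⋃ Z ∈ 𝓕, W Z := by
    rw [hVdec, Set.image_iUnion₂, h𝓕fin.closure_biUnion]
  -- a maximal non-empty `W Z₀`
  have hex : {Z ∈ 𝓕 | (W Z).Nonempty}.Nonempty := by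
    obtain ⟨x, hx⟩ := hVne
    rw [hVdec] at hx
    obtain ⟨Z, hZ, hxZ⟩ := Set.mem_iUnion₂.1 hx
    exact ⟨Z, hZ, ⟨φ x, subset_closure ⟨x, hxZ, rfl⟩⟩⟩
  obtain ⟨Z₀, ⟨hZ₀𝓕, hZ₀ne⟩, hZ₀max⟩ :=
    (h𝓕fin.subset (Set.sep_subset _ _)).exists_maximalFor W _ hex
  -- the piece `V ∩ Z₀` is non-empty, hence irreducible and locally closed
  have hV₀ne : (U ∩ Z₀).Nonempty := by
    by_contra h
    rw [Set.not_nonempty_iff_eq_empty] at h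
    simp [W, h] at hZ₀ne
  have hV₀irr : IsIrreducible (U ∩ Z₀) := isIrreducible_isOpen_inter (h𝓕irr Z₀ hZ₀𝓕) hU hV₀ne
  have hV₀lc : IsLocallyClosed (U ∩ Z₀) := ⟨U, Z₀, hU, h𝓕cl Z₀ hZ₀𝓕, rfl⟩
  obtain ⟨O, hO, hOne, hOsub⟩ :=
    exists_isOpen_inter_closure_image_subset_of_isIrreducible hV₀lc hV₀irr P hφ
  -- remove the components not containing `W Z₀`
  let S : Set (Set (σ → k)) := {Z ∈ 𝓕 | ¬ W Z₀ ⊆ W Z}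
  have hSfin : S.Finite := h𝓕fin.subset (Set.sep_subset _ _)
  have hWZ₀irr : IsIrreducible (W Z₀) := (hV₀irr.image φ hφ_cont.continuousOn).closure
  have hnot : ¬ W Z₀ ⊆ ⋃ Z ∈ S, W Z := by
    intro hsub
    obtain ⟨T, hT, hZ₀T⟩ := isIrreducible_iff_sUnion_isClosed.1 hWZ₀irr (hSfin.toFinset.image W)
      (by simp only [Finset.mem_image]; rintro _ ⟨Z, _, rfl⟩; exact isClosed_closure)
      (by
        rw [Finset.coe_image, Set.sUnion_image]
        intro y hy
        obtain ⟨Z, hZ, hyZ⟩ := Set.mem_iUnion₂.1 (hsub hy)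
        exact Set.mem_iUnion₂.2 ⟨Z, by simpa using hZ, hyZ⟩)
    obtain ⟨Z, hZ, rfl⟩ := Finset.mem_image.1 hT
    exact (hSfin.mem_toFinset.1 hZ).2 hZ₀T
  have hS_other : ∀ Z ∈ 𝓕, Z ∉ S → W Z ⊆ W Z₀ := by
    intro Z hZ hZS
    have hle : W Z₀ ⊆ W Z := by
      by_contra h; exact hZS ⟨hZ, h⟩
    by_cases hne : (W Z).Nonempty
    · exact hZ₀max ⟨hZ, hne⟩ hle
    · rw [Set.not_nonempty_iff_eq_empty] at hne
      rw [hne]; exact Set.empty_subset _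
  -- the open set
  have hScl : IsClosed (⋃ Z ∈ S, W Z) := hSfin.isClosed_biUnion fun Z _ => isClosed_closure
  refine ⟨O ∩ (⋃ Z ∈ S, W Z)ᶜ, hO.inter hScl.isOpen_compl, ?_, ?_⟩
  · -- two non-empty open subsets of the irreducible `W Z₀` meet
    obtain ⟨y, hy, hyS⟩ := Set.not_subset.1 hnot
    obtain ⟨w, hwO, hwW⟩ := hOne
    obtain ⟨z, hzW, hzO, hzS⟩ := hWZ₀irr.2 O (⋃ Z ∈ S, W Z)ᶜ hO hScl.isOpen_compl ⟨w, hwW, hwO⟩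
      ⟨y, hy, hyS⟩
    refine ⟨z, ⟨hzO, hzS⟩, ?_⟩
    rw [hcldec]
    exact Set.mem_iUnion₂.2 ⟨Z₀, hZ₀𝓕, hzW⟩
  · rintro y ⟨⟨hyO, hyS⟩, hycl⟩
    rw [hcldec] at hycl
    obtain ⟨Z, hZ, hyZ⟩ := Set.mem_iUnion₂.1 hycl
    have hZS : Z ∉ S := fun h => hyS (Set.mem_iUnion₂.2 ⟨Z, h, hyZ⟩)
    have hyZ₀ : y ∈ W Z₀ := hS_other Z hZ hZS hyZ
    obtain ⟨x, hx, rfl⟩ := hOsub ⟨hyO, hyZ₀⟩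
    refine ⟨x, ?_, rfl⟩
    rw [hVdec]
    exact Set.mem_iUnion₂.2 ⟨Z₀, hZ₀𝓕, hx⟩

end Chevalley

end Literature.NumberTheory.Automorphic
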